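import Mathlib
import HarnessLib
import HarnessLib.Audit
import Summits.MatrixMultiplication.Statement
import Literature.Computability.AlgebraicComplexity.MatrixMultiplicationExponent
import Literature.Computability.AlgebraicComplexity.SchoenhageTau
import Literature.Computability.AlgebraicComplexity.GroupAlgebraTensor
import HarnessLib.Audit.Status.Attr

/-!
Route: NilCoxeterShadow

X_NC (the nil-Coxeter shadow; REFUTATION line, targets ¬MatrixMultiplication; realises idea card
MatrixMultiplication/MatrixMultiplication/nilcoxeter-shadow). Let NC_n = gr_ℓ ℂ[S_n] be the
nil-Coxeter algebra (basis T_w, w ∈ S_n; T_x·T_y = T_{xy} if inv(xy) = inv(x)+inv(y), else 0; inv =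
number of inversions = Coxeter length; Fomin–Stanley's algebra of divided differences) and T_{NC_n}
∈ (ℂ^{n!})^{⊗3} its structure tensor. THESIS: the border rank of T_{NC_n} is super-polynomial in the
dimension along a subsequence — ∃ δ > 0 with bR(T_{NC_n}) ≥ (n!)^{1+δ} for infinitely many n. It
suffices: T_{NC_n} is a degeneration of T_{ℂ[S_n]} (Rees family of the length filtration, T_w ↦
ε^{inv w} T_w), so bR(T_{NC_n}) ≤ R(T_{ℂ[S_n]}) ≤ Σ_λ R(⟨d_λ,d_λ,d_λ⟩) (Wedderburn), and ω(ℂ) = 2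
would make the right-hand side ≤ C_ε (n!)^{1+ε} for every ε (Σ d_λ² = n!, d_λ ≤ (n!)^{1/2}); with ε
= δ/2 this contradicts the thesis, hence X_NC → ω(ℂ) ≠ 2 → ¬MatrixMultiplication. Contrapositively ω
= 2 PREDICTS that a canonical maximally non-commutative local graded algebra of dimension n! is
border-tame although provably not of minimal border rank.
Two-layer plan (D-0019): crux statements first (InductiveCosetGrowth, LinearBorderRigidity, the
negative PolynomialExcess), glue later (splits of the rank-2 crux along the parabolic tower only
once rank 3 closes); the frame (DegenerationTransfer, OmegaTwoGroupAlgebraRank, Assembly) is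
provable now from the cone.
Lean (elaborates, folder Sketch.lean = r1/Sketch1.lean, rc 0; NC_n inlined over Equiv.Perm (Fin n)
with inv w = #{(i,j) : i<j, w j < w i}; bR =
Literature.Computability.AlgebraicComplexity.algBorderRank, Bläser Def 6.1):
∃ δ : ℝ, 0 < δ ∧ ∀ n₀ : ℕ, ∃ n : ℕ, n₀ ≤ n ∧ (n.factorial : ℝ) ^ (1 + δ) ≤
(Literature.Computability.AlgebraicComplexity.algBorderRank (fun z x y : Equiv.Perm (Fin n) => if x
* y = z ∧ (Finset.univ.filter (fun p : Fin n × Fin n => p.1 < p.2 ∧ z p.2 < z p.1)).card =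
(Finset.univ.filter (fun p : Fin n × Fin n => p.1 < p.2 ∧ x p.2 < x p.1)).card + (Finset.univ.filter
(fun p : Fin n × Fin n => p.1 < p.2 ∧ y p.2 < y p.1)).card then (1 : ℂ) else 0) : ℝ)

Rationale: WHY THIS LINE (refutation side, widened by deformation theory of algebras + Coxeter/Schubert
combinatorics; card nilcoxeter-shadow). Every positive route must implicitly certify that EVERY
degeneration of T_{ℂ[S_n]} has border rank (n!)^{1+o(1)}; the canonical, maximally non-commutative
one is NC_n = gr ℂ[S_n] (equally the 0-Hecke algebra H_n(0)). Lower-bound technology has traction on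
structure tensors of algebras with a long radical filtration that it lacks on the generic-looking
⟨n,n,n⟩ (Landsberg2017 §5.6: Bläser's radical theorem Thm 5.6.3.2 [Bla00 Thm 7.4] gives R(T_{NC_n})
≥ 3·n! − o(n!) at once from the Mahonian length distribution, Rad^k = span{T_w : inv w ≥ k};
Bläser–Lysikov arXiv:1606.04253 = Landsberg2017 Thm 5.6.1.1/5.6.1.4 gives bR(T_{NC_n}) ≥ n!+1 for n
≥ 3, NC_n being unital and non-commutative hence not smoothable), and NC_n carries a grading torus,
a 0/1 support and the parabolic tower NC_{n-1} ⊂ NC_n (n cosets glued along Bruhat order) inviting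
INDUCTION. The transfer to ω is loss-free at the exponent level, and the whole frame is provable NOW
from the cone: WedderburnBlocks.exists_algEquiv_pi_matrix + sum_sq_blockDegrees_eq_card (PROVED),
GroupAlgebraTensor (groupTensor, block bound tensorRank_groupTensor_pi_le_of_algEquiv),
TensorRestrictionRank.exists_tensorRank_matMulTensor_le_rpow, SchoenhageTau (approxRank,
algBorderRank ≤ approxRank h). Imported areas: Rees degenerations of filtered algebras;
inversion/Mahonian statistics and parabolic decomposition of S_n; border substitution / border
apolarity (LandsbergMichalek2018) for the cruxes. Sources: arXiv:1606.04253, BlaserLysikov2020,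
Landsberg2017, LandsbergMichalek2018, BurgisserClausenShokrollahi1997 Ch.15/17, CohnUmans2003 §2.
RANKED CRUXES.
rank 2 InductiveCosetGrowth [crux]: ∃δ>0 ∃n₀ ∀n≥n₀, bR(T_{NC_{n+1}}) ≥ (n+1)^{1+δ}·bR(T_{NC_n}) —
the inductive engine along the parabolic decomposition NC_{n+1} = ⊕_{c} NC_n·T_c; implies X_NC
(bR(T_{NC_n}) ≥ c·(n!)^{1+δ}). Hardest and most informative.
rank 3 LinearBorderRigidity [crux]: ∃c>0, bR(T_{NC_n}) ≥ (2+c)·n! for all large n — the first step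
past n!+1 in BORDER rank (rank is already ≥ 3n!−o(n!)); inside the linear-rank-method cap, so
attackable today (Koszul flattenings with torus weights, border substitution along Rad^k, border
apolarity); a NO (bR ≤ 2·n!) strains the whole line.
rank 4 PolynomialExcess [crux, NEGATIVE side, staffed for refuters]: ∃C,k ∀n≥1, bR(T_{NC_n}) ≤
C·n^k·n! — tameness of the shadow (e.g. from an explicit degeneration of a padded unit tensor / a
smoothable Mahonian monomial algebra); proving it refutes X_NC and closes the route while confirming
the ω = 2 prediction for this family with room to spare.
SUPPORT (rank 9, provable now): DegenerationTransfer ∀n, bR(T_{NC_n}) ≤ R(T_{ℂ[S_n]}) (from any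
exact decomposition Σ_ρ w_ρ⊗u_ρ⊗v_ρ of groupTensor ℂ S_n put u(x) ↦ ε^{inv x}u(x), v(y) ↦ ε^{inv
y}v(y), w(z) ↦ ε^{h−inv z}w(z), h = n(n−1)/2: an order-h approximate decomposition of T_{NC_n}, so
approxRank h ≤ R and algBorderRank ≤ approxRank h); OmegaTwoGroupAlgebraRank: MatrixMultiplication →
∀ε>0 ∃C ∀ finite groups G, R(T_{ℂ[G]}) ≤ C·|G|^{1+ε} (Wedderburn blocks, Σd²=|G|, d ≤ |G|^{1/2},
R(⟨d,d,d⟩) ≤ C′d^{2+ε}).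
TARGET AThesis = X_NC (rank 0). ASSEMBLY (rank 1): AThesis → ¬MatrixMultiplication — from the two
support items ((n!)^{1+δ} ≤ C_{δ/2}(n!)^{1+δ/2} for infinitely many n is absurd since n! → ∞; |S_n|
= n! is Fintype.card_perm).
KILL CRITERIA: PolynomialExcess proved, or any bR(T_{NC_n}) ≤ (n!)^{1+o(1)}; any positive route's
thesis proved (ω = 2 refutes X_NC via Assembly's contrapositive); certified small-n data with
bR(T_{NC_n})/n! decreasing towards 1 demotes ranks 2–3 (tenure: pivot to H_n(0) or close exhausted).
NOT DECOMPOSED YET: which equations carry rank 3 (Koszul vs border apolarity vs border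
substitution); the 0-Hecke sibling H_n(0) (same transfer; a new decl only if NC_n stalls); certified
computations bR/R of T_{NC_3} (6×6×6) and T_{NC_4} (24³) — requested as computation items only after
rank 3 is grounded; a spectral-point formulation (a point F with F(T_{NC_n}) ≥ (n!)^{1+δ}) is
equivalent bookkeeping and deliberately not filed.

Novelty: NOVELTY (search-before-claim 2026-08-15: `lit search --hybrid` / `lit vsearch` "nil-Coxeter /
0-Hecke structure tensor border rank" over the local index — only Landsberg2017 §5.6 pp.141–148
(structure tensors of algebras: BL16 reduction Thm 5.6.1.1/5.6.1.4, Bläser radical Thm 5.6.3.2,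
Alder–Strassen Rem 5.6.3.5, Zuiddam W-state Thm 5.6.3.8, smoothable/monomial Prop 5.6.5.1), no NC_n
or H_n(0); `lit galaxy search "nilCoxeter algebra" --star all` (13 rows, all Schubert-calculus
structure theory: Fomin–Kirillov dimension arXiv:2001.04597, tower diagrams/Pieri arXiv:1807.03764,
Hecke group algebras arXiv:0804.3781, Demazure operators for double cosets arXiv:2307.15021 — no
complexity content); galaxy pdf "bilinear complexity group algebra symmetric group" and "0-Hecke
algebra tensor rank" (0 hits); the remote searchd cascade was unavailable (rc 75) — the card's
refuter audit (novelty-audit-10-g2) ran arXiv "nilCoxeter algebra" (8, structural), "0-Hecke algebra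
structure tensor rank" (0), "border rank group algebra structure tensor lower bound" (0).)
Nearest prior art: (i) folklore ω = 2 ⇒ R(T_{ℂ[G]}) ≤ |G|^{1+o(1)} via Wedderburn
(BurgisserClausenShokrollahi1997 Ch.15; CohnUmans2003 §2 uses the converse direction; in-tree
GroupAlgebraTensor + WedderburnBlocks); (ii) algebra degenerations induce structure-tensor
degenerations with bR monotone, and binding tensors of minimal border rank = smoothable algebras
(Bläser–Lysikov arXiv:1606.04253 = Landsberg2017 Thm 5.6.1.1/5.6.1.4; Blas  [refs: 2001.04597, 1807.03764, 0804.3781, 2307.15021, 1606.04253, Landsberg2017, BurgisserClausenShokrollahi1997, CohnUmans2003, BlaserLysikov2020, LandsbergMichalek2018]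

Barriers (technique_class: border-rank-lower-bound, degeneration-transfer): BARRIERS (technique_class: border-rank-lower-bound, degeneration-transfer; catalogue
Literature/Barriers/MatrixMultiplication/* read 2026-08-15, 12 entries).
- Literature.Barriers.MatrixMultiplication.LinearRankMethodBarrier
(EfremenkoGargOliveiraWigderson2018 Thm 4.4 / Buczyński; determinantal = linear rank methods certify
border rank at most linearly in the format, ≤ 6N−4 type caps): APPLIES verbatim to T_{NC_n} ∈
(ℂ^N)^{⊗3}, N = n!: flattenings / Koszul / Young flattenings alone can certify neither X_NC
((n!)^{1+δ}) nor InductiveCosetGrowth asymptotically; they CAN still settle LinearBorderRigidity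
((2+c)·N lies inside the cap) and the small-n data. Evasion = the stated bet: border SUBSTITUTION /
border APOLARITY iterated along the radical = length filtration Rad^k = span{T_w : inv w ≥ k}
(length n(n−1)/2, growing) with the grading-torus fixed-point reduction — a class the barrier source
itself leaves open (whether border apolarity / border substitution are cactus-bounded is open) —
and, failing that, genuinely non-linear secant equations evaluated on a 0/1 graded tensor, a
friendlier test bed than ⟨n,n,n⟩. The route is honest that a NEW lower-bound technique is needed for
X_NC, exactly as for route BorderRankLowerBound; its added value is the test object and the
inductive structure.
- Literature.Barriers.MatrixMultiplication.UnstableTensorBarrier (BlaserLysikov2020): bars UPPER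
bounds on ω from powers of unstable / non-semisimple structure tensors; here the unstable local

History (route lifecycle, newest last):
- 2026-08-15T16:14:01Z · rev 3: restated Assembly (stmt-MatrixMultiplication-0957) — route-repair: align the Assembly item with the certified deciding theorem (drop refused by gate; restate as suggested). No crux touched. (planner-rbadge-MatrixMultiplication-NilCoxeter-022edee4-g2-0)
- 2026-08-16T04:11:03Z · AUTO-CRUX (backfill): AThesis — hypotheses of the deciding theorem that nothing in the route derives are cruxes (operator:999:1085951)

sub-problem: MatrixMultiplication · status: open · opened planner-plancards-MatrixMultiplication-MatrixMultiplication-20260815w1-1-0 2026-08-15T10:37:42Z · rev 3 · ledger route-MatrixMultiplication-NilCoxeterShadow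
GENERATED by the gate from the ledger (D-0016/17). Provers cite these decls: `theorem foo : Summit.MatrixMultiplication.MatrixMultiplication.Theses.NilCoxeterShadow.<Decl> := …` in Summits/MatrixMultiplication/MatrixMultiplication/Theorems/<Name>.lean.
-/

namespace Summit.MatrixMultiplication.MatrixMultiplication.Theses.NilCoxeterShadow

open scoped BigOperators Topology Manifold Classical MeasureTheory ProbabilityTheory Matrix InnerProductSpace ComplexConjugate ContinuousMap
open Filter Set Function TopologicalSpace MeasureTheory

attribute [summit_statement] _root_.MatrixMultiplication

/-- item stmt-MatrixMultiplication-0956 · crux (kind.auto-crux: conjecture-grade) · rank 0 · open · by planner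
why it might fail: False if ω=2 (Assembly's contrapositive: bR(T_NC_n) ≤ R(ℂ[S_n]) ≤ C_ε(n!)^{1+ε}). Needs a super-linear border-rank lower bound on an explicit tensor, beyond all known methods (frontier 2.02m, arXiv:1912.11927; rank-method cap 6m−4, Buczynski2026); NC_n may be border-tame cheaply (PolynomialExcess).
sources: BlaserLysikov2016, Landsberg2017, LandsbergMichalek2019Haystack, Buczynski2026, BurgisserClausenShokrollahi1997
[target] X_NC: ∃δ>0, bR(T_{NC_n}) ≥ (n!)^{1+δ} for infinitely many n, T_{NC_n} the structure tensor
of the nil-Coxeter algebra NC_n = gr ℂ[S_n] (entry (z,x,y) = [x·y = z ∧ inv z = inv x + inv y] on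
Equiv.Perm (Fin n), inv = inversion number), bR = algBorderRank over ℂ[ε] (Blaser2013 Def 6.1).
Lower frame known: bR ≥ n!+1 for n ≥ 3 (Bläser–Lysikov arXiv:1606.04253: unital non-commutative ⇒
not smoothable ⇒ not minimal border rank), R ≥ 3·n! − o(n!) (Bläser radical theorem, Landsberg2017
Thm 5.6.3.2 + Mahonian distribution). Card nilcoxeter-shadow. -/
@[route_item "route-MatrixMultiplication-NilCoxeterShadow", crux]
def AThesis : Prop :=
  ∃ δ : ℝ, 0 < δ ∧ ∀ n₀ : ℕ, ∃ n : ℕ, n₀ ≤ n ∧ (n.factorial : ℝ) ^ (1 + δ) ≤ (Literature.Computability.AlgebraicComplexity.algBorderRank (fun z x y : Equiv.Perm (Fin n) => if x * y = z ∧ (Finset.univ.filter (fun p : Fin n × Fin n => p.1 < p.2 ∧ z p.2 < z p.1)).card = (Finset.univ.filter (fun p : Fin n × Fin n => p.1 < p.2 ∧ x p.2 < x p.1)).card + (Finset.univ.filter (fun p : Fin n × Fin n => p.1 < p.2 ∧ y p.2 < y p.1)).card then (1 : ℂ) else 0) : ℝ)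

/-- item stmt-MatrixMultiplication-0958 · crux · rank 2 · open · by planner
why it might fail: False if ω=2 (bR(T_NC_n) ≤ R(ℂ[S_n]) = (n!)^{1+o(1)}). Demands a uniform (n+1)^{1+δ} gain at EVERY large n, stronger than AThesis; no super-linear border-rank certificate exists for any explicit tensor (frontier 2.02m, arXiv:1912.11927; rank methods cap at 6m−4, Buczynski2026).
sources: BlaserLysikov2016, LandsbergMichalek2019Haystack, Buczynski2026, EfremenkoGargOliveiraWigderson2018, Landsberg2017
[crux] The inductive engine: ∃δ>0 ∃n₀ ∀n≥n₀, bR(T_{NC_{n+1}}) ≥ (n+1)^{1+δ}·bR(T_{NC_n}). Along the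
parabolic decomposition NC_{n+1} = ⊕_{c} NC_n·T_c (n+1 minimal coset representatives, lengths add;
cosets glued by Bruhat order) each coset layer should add an amount that GROWS with the layer
(longer Bruhat intervals) — the hoped-for source of super-linearity; implies AThesis (bR(T_{NC_n}) ≥
c·(n!)^{1+δ}). Tools: border substitution / border apolarity along Rad^k = span{T_w : inv w ≥ k}
with the grading torus; flattening only gives the factor (n+1). Source: card nilcoxeter-shadow §What
it needs (3). -/
@[route_item "route-MatrixMultiplication-NilCoxeterShadow"]
def InductiveCosetGrowth : Prop :=
  ∃ δ : ℝ, 0 < δ ∧ ∃ n₀ : ℕ, ∀ n : ℕ, n₀ ≤ n → ((n : ℝ) + 1) ^ (1 + δ) * (Literature.Computability.AlgebraicComplexity.algBorderRank (fun z x y : Equiv.Perm (Fin n) => if x * y = z ∧ (Finset.univ.filter (fun p : Fin n × Fin n => p.1 < p.2 ∧ z p.2 < z p.1)).card = (Finset.univ.filter (fun p : Fin n × Fin n => p.1 < p.2 ∧ x p.2 < x p.1)).card + (Finset.univ.filter (fun p : Fin n × Fin n => p.1 < p.2 ∧ y p.2 < y p.1)).card then (1 : ℂ) else 0) : ℝ)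 ≤ (Literature.Computability.AlgebraicComplexity.algBorderRank (fun z x y : Equiv.Perm (Fin (n + 1)) => if x * y = z ∧ (Finset.univ.filter (fun p : Fin (n + 1) × Fin (n + 1) => p.1 < p.2 ∧ z p.2 < z p.1)).card = (Finset.univ.filter (fun p : Fin (n + 1) × Fin (n + 1) => p.1 < p.2 ∧ x p.2 < x p.1)).card + (Finset.univ.filter (fun p : Fin (n + 1) × Fin (n + 1) => p.1 < p.2 ∧ y p.2 < y p.1)).card then (1 : ℂ) else 0) : ℝ)

/-- item stmt-MatrixMultiplication-0959 · crux · rank 3 · open · by planner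
why it might fail: bR may be ≤ 2·n!: algebra tensors compress in the border setting (Landsberg2017 Rem 5.6.3.4; A_trunc, W^{⊗n} have R/bR → 3 with bR = dim). And (2+c)m at m = n! would beat the explicit-tensor frontier 2.02m (arXiv:1912.11927, astronomically large m only); Koszul flattenings alone stop below 2m.
sources: Landsberg2017, LandsbergMichalek2019Haystack, LandsbergMichalek2018, BlaserLysikov2016, LandsbergOttaviani2015
[crux] First step past minimal-border-rank-plus-one: ∃c>0, bR(T_{NC_n}) ≥ (2+c)·n! for all large n
(eventually-form: at n = 3 the format 6×6×6 has generic border rank 14, so a uniform constant would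
be noise). Known: bR ≥ n!+1 (n ≥ 3; Bläser–Lysikov arXiv:1606.04253 = Landsberg2017 Thm 5.6.1.4:
binding + not smoothable), rank R(T_{NC_n}) ≥ 3·n! − o(n!) (Bläser 2000 = Landsberg2017 Thm 5.6.3.2
with Rad^k = span{T_w : inv w ≥ k} and the Mahonian concentration of inv), R ≥ 2·n! − 1
(Alder–Strassen, one maximal ideal; Landsberg2017 Rem 5.6.3.5). Border rank in the window (n!+1,
3·n!] is open and INSIDE the linear-rank-method cap, so Koszul flattenings with torus weights,
border substitution (LandsbergMichalek2018) and border apolarity can all be tried; n = 3 (6×6×6) and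
n = 4 (24³) are certifiable computations. Informative both ways: ≤ 2·n! would show NC_n compresses
like A_trunc (Landsberg2017 Rem 5.6.3.4) and demote the line. -/
@[route_item "route-MatrixMultiplication-NilCoxeterShadow"]
def LinearBorderRigidity : Prop :=
  ∃ c : ℝ, 0 < c ∧ ∀ᶠ n : ℕ in Filter.atTop, (2 + c) * (n.factorial : ℝ) ≤ (Literature.Computability.AlgebraicComplexity.algBorderRank (fun z x y : Equiv.Perm (Fin n) => if x * y = z ∧ (Finset.univ.filter (fun p : Fin n × Fin n => p.1 < p.2 ∧ z p.2 < z p.1)).card = (Finset.univ.filter (fun p : Fin n × Fin n => p.1 < p.2 ∧ x p.2 < x p.1)).card + (Finset.univ.filter (fun p : Fin n × Fin n => p.1 < p.2 ∧ y p.2 < y p.1)).card then (1 : ℂ) else 0) : ℝ)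

/-- item stmt-MatrixMultiplication-0960 · crux · rank 4 · open · by planner
why it might fail: NC_n (n ≥ 3) is unital non-commutative ⇒ not smoothable ⇒ bR ≥ n!+1 (BL16, Landsberg2017 Thm 5.6.1.4), so no minimal-border-rank scheme; no padded-unit degeneration of size n!·poly(n) is known; even ω=2 yields only (n!)^{1+o(1)}, not n!·n^{O(1)}; if ω>2 nothing forces tameness.
sources: BlaserLysikov2016, Landsberg2017, BlaserLysikov2020, CohnUmans2003
[crux, NEGATIVE side — staffed for refuters; proving it closes the route refuted:AThesis] Tameness
of the shadow: ∃C,k ∀n≥1, bR(T_{NC_n}) ≤ C·n^k·n!, i.e. bR(gr ℂ[S_n]) = n!·n^{O(1)} — the ω = 2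
prediction for this family with room to spare (ω = 2 only gives (n!)^{1+o(1)}). Natural mechanisms:
an explicit degeneration ⟨n!·poly(n)⟩ ⊵ T_{NC_n} (e.g. through a smoothable commutative monomial
algebra with Mahonian Hilbert series plus a border correction for the non-commutative twist), or a
direct ε-scheme exploiting that NC_n is monomial (T_x T_y ∈ {0, T_{xy}}). Strictly stronger than
¬AThesis; filed so that the cheap-reason risk of the line is attacked head-on. -/
@[route_item "route-MatrixMultiplication-NilCoxeterShadow"]
def PolynomialExcess : Prop :=
  ∃ C k : ℕ, ∀ n : ℕ, 1 ≤ n → Literature.Computability.AlgebraicComplexity.algBorderRank (fun z x y : Equiv.Perm (Fin n) => if x * y = z ∧ (Finset.univ.filter (fun p : Fin n × Fin n => p.1 < p.2 ∧ z p.2 < z p.1)).card = (Finset.univ.filter (fun p : Fin n × Fin n => p.1 < p.2 ∧ x p.2 < x p.1)).card + (Finset.univ.filter (fun p : Fin n × Fin n => p.1 < p.2 ∧ y p.2 < y p.1)).card then (1 : ℂ) else 0) ≤ C * n ^ k * n.factorial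

/-- item stmt-MatrixMultiplication-0961 · support · rank 9 · closed · proved by Summit.MatrixMultiplication.MatrixMultiplication.Theorems.degenerationTransfer_proof @ 614fa71ac06a (prover) · by planner
sources: arXiv:1606.04253, Blaser2013, Landsberg2017
[support, provable now] ∀n, bR(T_{NC_n}) ≤ R(T_{ℂ[S_n]}) with T_{ℂ[S_n]} = groupTensor ℂ (Equiv.Perm
(Fin n)) (entry [x·y = z]). Proof: from an exact decomposition groupTensor = Σ_{ρ<r} triad (w_ρ)
(u_ρ) (v_ρ), r = tensorRank, put h = n(n−1)/2 and W_ρ(z) = X^{h − inv z}·C(w_ρ z), U_ρ(x) = X^{inv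
x}·C(u_ρ x), V_ρ(y) = X^{inv y}·C(v_ρ y) ∈ ℂ[X]: Σ_ρ W_ρ(z)U_ρ(x)V_ρ(y) = X^{h + inv x + inv y − inv
z}·[x·y = z], and inv(x·y) ≤ inv x + inv y with equality iff the NC_n entry is 1, so this
IsApproxDecomposition h (T_{NC_n}) (SchoenhageTau.lean Def 6.1); hence algBorderRank ≤ approxRank h
≤ r. This is the tensor shadow of the Rees degeneration gr_ℓ ℂ[S_n] = NC_n (Bläser–Lysikov
arXiv:1606.04253 §2; Landsberg2017 Thm 5.6.1.1). Needs the subadditivity of the inversion number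
under composition (Mathlib: prove via Equiv.Perm.sign? no — directly by counting pairs). -/
@[route_item "route-MatrixMultiplication-NilCoxeterShadow", crux]
def DegenerationTransfer : Prop :=
  ∀ n : ℕ, Literature.Computability.AlgebraicComplexity.algBorderRank (fun z x y : Equiv.Perm (Fin n) => if x * y = z ∧ (Finset.univ.filter (fun p : Fin n × Fin n => p.1 < p.2 ∧ z p.2 < z p.1)).card = (Finset.univ.filter (fun p : Fin n × Fin n => p.1 < p.2 ∧ x p.2 < x p.1)).card + (Finset.univ.filter (fun p : Fin n × Fin n => p.1 < p.2 ∧ y p.2 < y p.1)).card then (1 : ℂ) else 0) ≤ Literature.Computability.AlgebraicComplexity.tensorRank (Literature.Computability.AlgebraicComplexity.groupTensor ℂ (Equiv.Perm (Fin n)))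

/-- item stmt-MatrixMultiplication-0962 · support · rank 9 · closed · proved by Summit.MatrixMultiplication.MatrixMultiplication.Theorems.omegaTwoGroupAlgebraRank_proof @ 4c5a6d2816cd (prover) · by planner
sources: CohnUmans2003, BurgisserClausenShokrollahi1997, Blaser2013
[support, provable now] MatrixMultiplication (ω(ℂ) = 2) → ∀ε>0 ∃C ∀ finite groups G, R(T_{ℂ[G]}) ≤
C·|G|^{1+ε}. Proof from the cone: Wedderburn φ : ℂ[G] ≃ₐ ∏_i M_{d_i}(ℂ)
(WedderburnBlocks.exists_algEquiv_pi_matrix, PROVED) ⇒ R(groupTensor ℂ G) ≤ Σ_i R(⟨d_i,d_i,d_i⟩)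
(GroupAlgebraTensor: structureTensor_restrictsTo_of_algEquiv +
structureTensor_blockBasis_eq_matMulDirectSum + sum_blockMask/tensorRank_sum_le, or
tensorRank_groupTensor_pi_le_of_algEquiv at N = 1 after reindexing Fin 1 → G ≃ G); R(⟨d,d,d⟩) ≤
C′·d^{ω+2ε} = C′·d^{2+2ε} (TensorRestrictionRank.exists_tensorRank_matMulTensor_le_rpow); Σ_i
d_i^{2+2ε} ≤ (max d_i)^{2ε}·Σ d_i² ≤ |G|^{ε}·|G| (sum_sq_blockDegrees_eq_card). Folklore
(BurgisserClausenShokrollahi1997 Ch.15; CohnUmans2003 §2, converse direction). -/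
@[route_item "route-MatrixMultiplication-NilCoxeterShadow", crux]
def OmegaTwoGroupAlgebraRank : Prop :=
  MatrixMultiplication → ∀ ε : ℝ, 0 < ε → ∃ C : ℝ, ∀ (G : Type) [Group G] [Fintype G] [DecidableEq G], (Literature.Computability.AlgebraicComplexity.tensorRank (Literature.Computability.AlgebraicComplexity.groupTensor ℂ (G)) : ℝ) ≤ C * (Fintype.card G : ℝ) ^ (1 + ε)

-- earlier Assembly (stmt-MatrixMultiplication-0957, replaced 2026-08-15T16:14:01Z -> stmt-MatrixMultiplication-10388): retired by None — (∃ δ : ℝ, 0 < δ ∧ ∀ n₀ : ℕ, ∃ n : ℕ, n₀ ≤ n ∧ (n.factorial : ℝ) ^ (1 + δ) ≤ (Literature.Computability.AlgebraicComplexity.algBorderRank (fun z x y : Equiv.Perm (Fin n) => if x * y = z ∧ (Finset.univ.filter (fun p : Fin n × Fin n => p.1 < p.2 ∧ z p.2 < z p.1)).card 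
/-- item stmt-MatrixMultiplication-10388 · assembly · rank 1 · closed · proved by Summit.MatrixMultiplication.MatrixMultiplication.Theorems.nilCoxeterShadow_assembly_proof @ 7ac08aa6932c (prover) · by planner
sources: CohnUmans2003, BurgisserClausenShokrollahi1997
[assembly] AThesis → DegenerationTransfer → OmegaTwoGroupAlgebraRank → ¬MatrixMultiplication —
literally the type of the deciding theorem `closes` (rev 2, glue_ok): provable in one line `fun hT
hD hO => closes hT hD hO`. Replaces the rev-1 form (AThesis body inlined, the two supports left
implicit), which the gate flagged glue.extra-hypothesis and which refuter/grounder notes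
(2026-08-15) observed was provable only after 0961/0962 land; the mathematical content (ε = δ/2:
(n!)^{1+δ} ≤ C(n!)^{1+δ/2} infinitely often contradicts n! → ∞, |S_n| = n! by Fintype.card_perm) now
lives in `closes`. -/
@[route_item "route-MatrixMultiplication-NilCoxeterShadow"]
def Assembly : Prop :=
  AThesis → DegenerationTransfer → OmegaTwoGroupAlgebraRank → ¬ MatrixMultiplication

/-! D-0027 §2.1 — DECIDING THEOREM (planner-authored via `route open/edit --closes-file`; by planner-rbadge-MatrixMultiplication-NilCoxeter-022edee4-g2-0 2026-08-15T16:12:48Z):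
its hypotheses are this route's items and its conclusion the sub-problem Statement (glue_lint), and it elaborates with this file. -/

/-- DECIDING THEOREM (D-0027 §2.1, refutation line): the thesis `AThesis` (= X_NC) together with the
two support items `DegenerationTransfer` (bR(T_{NC_n}) ≤ R(T_{ℂ[S_n]})) and
`OmegaTwoGroupAlgebraRank` (ω(ℂ)=2 → R(T_{ℂ[G]}) ≤ C_ε |G|^{1+ε}) refutes `ω(ℂ) = 2`:
at ε = δ/2, (n!)^{1+δ} ≤ bR(T_{NC_n}) ≤ R(T_{ℂ[S_n]}) ≤ C (n!)^{1+δ/2} for infinitely many n,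
i.e. (n!)^{δ/2} ≤ C infinitely often — absurd since n! ≥ n → ∞ (|S_n| = n!, `Fintype.card_perm`). -/
@[closes "route-MatrixMultiplication-NilCoxeterShadow"] theorem closes (hT : AThesis) (hD : DegenerationTransfer) (hO : OmegaTwoGroupAlgebraRank) :
    ¬ _root_.MatrixMultiplication := by
  intro hMM
  obtain ⟨δ, hδ, hinf⟩ := hT
  obtain ⟨C, hC⟩ := hO hMM (δ / 2) (by linarith)
  have hMpos : 0 < max C 1 := lt_of_lt_of_le one_pos (le_max_right _ _)
  obtain ⟨N, hN⟩ := exists_nat_gt ((max C 1) ^ (2 / δ))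
  obtain ⟨n, hNn, hn⟩ := hinf N
  have h1' := (Nat.cast_le (α := ℝ)).mpr (hD n)
  have h2 := hC (Equiv.Perm (Fin n))
  rw [Fintype.card_perm, Fintype.card_fin] at h2
  have h3 : ((n.factorial : ℕ) : ℝ) ^ (1 + δ) ≤ C * ((n.factorial : ℕ) : ℝ) ^ (1 + δ / 2) :=
    hn.trans (h1'.trans h2)
  have hfpos : (0 : ℝ) < (n.factorial : ℕ) := by exact_mod_cast n.factorial_pos
  rw [show (1 + δ) = δ / 2 + (1 + δ / 2) by ring, Real.rpow_add hfpos] at h3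
  have h4 : ((n.factorial : ℕ) : ℝ) ^ (δ / 2) ≤ C :=
    le_of_mul_le_mul_right h3 (Real.rpow_pos_of_pos hfpos _)
  have h5 : (N : ℝ) ≤ ((n.factorial : ℕ) : ℝ) := by exact_mod_cast hNn.trans n.self_le_factorial
  have h6 : max C 1 < (N : ℝ) ^ (δ / 2) := by
    have hδ2 : (2 / δ) * (δ / 2) = 1 := by field_simp
    have : ((max C 1) ^ (2 / δ)) ^ (δ / 2) = max C 1 := by
      rw [← Real.rpow_mul hMpos.le, hδ2, Real.rpow_one]
    calc max C 1 = ((max C 1) ^ (2 / δ)) ^ (δ / 2) := this.symm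
      _ < (N : ℝ) ^ (δ / 2) := Real.rpow_lt_rpow (Real.rpow_nonneg hMpos.le _) hN (by positivity)
  have h7 : (N : ℝ) ^ (δ / 2) ≤ ((n.factorial : ℕ) : ℝ) ^ (δ / 2) :=
    Real.rpow_le_rpow (Nat.cast_nonneg _) h5 (by positivity)
  linarith [le_max_left C 1]

end Summit.MatrixMultiplication.MatrixMultiplication.Theses.NilCoxeterShadow
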